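import Summits.QuantumFields.YangMills.Theorems.ColdStartUniversalityLatticeLangevinLoopAverageCarre
import HarnessLib

/-!
# Route `ColdStartUniversality` (fixed-cut-off package): the carré du champ of a BLOCK-AVERAGED Wilson loop — SPARSITY-AWARE bound
# `Γ(c·Σ_(x∈B) Re tr w(ℓ + x)) ≤ 32·c²·|ℓ|²·#B` on `SU(2)^E` for every finite set `B` of base points

Helper file (seat `ym-line-csu-p1`, g28; `--supports stmt-QuantumFields-24809`).  g27's `wilson_loopAverage_carreBound` bounds each frame derivative
by `2|c||ℓ|` and sums over ALL `8#E` noise directions (`32c²|ℓ|²#E`), which is sharp for the torus average but useless for a LOCAL average over a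
block `B` of base points (most frame derivatives vanish).  Here the sum is organised as `Σ_n D_n² ≤ (max_n |D_n|/S_n)·… ≤ 4c²|ℓ|·Σ_n S_n` with the
incidence numbers `S_n = Σ_(x∈B) m_(n.1)(w(ℓ+x)) ≤ |ℓ|` and `Σ_n S_n = 8|ℓ|·#B`:
* ★★ `wilson_blockLoopAverage_carreBound` — `Σ_n (D(c Σ_(x∈B) Re tr w(ℓ+x))(y)[σ_n y])² ≤ 32 c²|ℓ|²·#B`;
* `contDiff_blockLoopAverage`;
* ★★ `wilson_blockLoopAverage_carre_le` — coordinate carré-du-champ form; with `c = 1/(2#B)` (block average of the `SU(2)` Wilson loop `½Re tr`):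
  `Γ(W̄_B) ≤ 8|ℓ|²/#B = 32(R+T)²/#B` for an `R × T` rectangle.
Use (`…LatticeLangevinBlockLoopMixing`): LOCAL averaged loops — the crux's observable scale (unit physical blocks, `#B = ε_K⁻³`) — inherit the
transport–entropy mixing bounds with `s = 32(R+T)²/#B`, i.e. constants `∝ √(L³/#B)` = √(number of blocks), logarithmic thresholds in `L³/#B`.
THEOREMS ONLY, no definition, no sorry.  HONEST FRAMING: fixed-cut-off plumbing; nothing K-uniform; no crux, rung or summit statement is proved; the
Yang–Mills mass gap is NOT proved.
-/

set_option autoImplicit false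

noncomputable section

namespace Summit.QuantumFields.YangMills.Theorems.ColdStartUniversality

open MeasureTheory Matrix Complex Finset
open scoped ComplexConjugate BigOperators Matrix
open Literature.MathematicalPhysics.QuantumFieldTheory
open Literature.MathematicalPhysics.QuantumLattice (fundamentalRep fundamentalLatticeRep continuous_fundamentalRep fundamentalRep_apply)
open Summit.Ventures.YMGap.HessianSharp (frobSq reTrCLM)

variable {L : ℕ} [NeZero L]

/-! ## §1. The sparsity-aware frame bound -/

section Calculus

set_option backward.isDefEq.respectTransparency false

open scoped Matrix.Norms.Operator

/-- ★★ **`Γ(c·Σ_(x∈B) Re tr w(ℓ+x)) ≤ 32 c²|ℓ|²·#B` pointwise** on `SU(2)^E`, for every finite set `B` of base points (SPARSITY-AWARE: the bound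
scales with the number `#B` of translates, not with `#E`): `Σ_n (D(c Σ_(x∈B) Re tr w(ℓ+x))(y)[σ_n y])² ≤ 32·c²·|ℓ|²·#B` (`y = coords V`;
`|W_n(Re tr w)| ≤ 2m_(n.1)(w)`, `S_n := Σ_(x∈B) m_(n.1)(w(ℓ+x)) ≤ |ℓ|`, `Σ_n S_n = 8|ℓ|·#B`, and `Σ_n D_n² ≤ (2|c|)²·|ℓ|·Σ_n S_n`). [folklore] -/
theorem wilson_blockLoopAverage_carreBound (L : ℕ) [NeZero L] (ps : List (Site 3 L × Fin 3 × Bool)) (c : ℝ) (B : Finset (Site 3 L)) (V : (GaugeConfig 3 L (Matrix.specialUnitaryGroup (Fin 2) ℂ))) :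
    ∑ n : Edge 3 L × NoiseIdx (fundamentalLatticeRep 2).N, (fderiv ℝ (fun y : (Edge 3 L × Fin (fundamentalLatticeRep 2).N × Fin (fundamentalLatticeRep 2).N × Bool → ℝ) => c * ∑ x ∈ B, ((((ps.map (fun q : Site 3 L × Fin 3 × Bool => ((x + q.1, q.2.1), q.2.2))).map (fun a : Edge 3 L × Bool => if a.2 then ((fun (ee : Edge 3 L) => Matrix.of fun (i j : Fin (fundamentalLatticeRep 2).N) => ((y (ee, i, j, false) : ℝ) : ℂ) + ((y (ee, i, j, true) : ℝ) : ℂ) * Complex.I) a.1)ᴴ else (fun (ee : Edge 3 L) => Matrix.of fun (i j : Fin (fundamentalLatticeRep 2).N) => ((y (ee, i, j, false) : ℝ) : ℂ) + ((y (ee, i, j, true) : ℝ) : ℂ) * Complex.I) a.1)).prod)).trace.re) ((fun (V : GaugeConfig 3 L (Matrix.specialUnitaryGroup (Fin 2) ℂ)) (q : Edge 3 L × Fin (fundamentalLatticeRep 2).N × Fin (fundamentalLatticeRep 2).N × Bool) => (fun z : ℂ => if q.2.2.2 then z.im else z.re) ((fundamentalRep (Fin 2) (V q.1) : Matrix (Fin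 2) (Fin 2) ℂ) q.2.1 q.2.2.1)) V) (fun q : Edge 3 L × Fin (fundamentalLatticeRep 2).N × Fin (fundamentalLatticeRep 2).N × Bool => if n.1 = q.1 then (fun z : ℂ => if q.2.2.2 then z.im else z.re) (((Real.sqrt 2 : ℂ) • ((fundamentalLatticeRep 2).lieProj (noiseDir n.2) * (fun (ee : Edge 3 L) => Matrix.of fun (i j : Fin (fundamentalLatticeRep 2).N) => (((fun (V : GaugeConfig 3 L (Matrix.specialUnitaryGroup (Fin 2) ℂ)) (q : Edge 3 L × Fin (fundamentalLatticeRep 2).N × Fin (fundamentalLatticeRep 2).N × Bool) => (fun z : ℂ => if q.2.2.2 then z.im else z.re) ((fundamentalRep (Fin 2) (V q.1) : Matrix (Fin 2) (Fin 2) ℂ) q.2.1 q.2.2.1)) V (ee, i, j, false) : ℝ) : ℂ) + (((fun (V : GaugeConfig 3 L (Matrix.specialUnitaryGroup (Fin 2) ℂ)) (q : Edge 3 L × Fin (fundamentalLatticeRep 2).N × Fin (fundamentalLatticeRep 2).N × Bool) => (fun z : ℂ => if q.2.2.2 then z.im else z.re) ((fundamentalRep (Fin 2) (V q.1) : Matrix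 (Fin 2) (Fin 2) ℂ) q.2.1 q.2.2.1)) V (ee, i, j, true) : ℝ) : ℂ) * Complex.I) q.1)) q.2.1 q.2.2.1) else 0)) ^ 2
      ≤ 32 * c ^ 2 * (ps.length : ℝ) ^ 2 * (B.card : ℝ) := by
  classical
  set reb : (Edge 3 L × Fin (fundamentalLatticeRep 2).N × Fin (fundamentalLatticeRep 2).N × Bool → ℝ) → (Edge 3 L → Matrix (Fin (fundamentalLatticeRep 2).N) (Fin (fundamentalLatticeRep 2).N) ℂ) := fun z => (fun (ee : Edge 3 L) => Matrix.of fun (i j : Fin (fundamentalLatticeRep 2).N) => ((z (ee, i, j, false) : ℝ) : ℂ) + ((z (ee, i, j, true) : ℝ) : ℂ) * Complex.I) with hreb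
  set y₀ : (Edge 3 L × Fin (fundamentalLatticeRep 2).N × Fin (fundamentalLatticeRep 2).N × Bool → ℝ) := (fun (V : GaugeConfig 3 L (Matrix.specialUnitaryGroup (Fin 2) ℂ)) (q : Edge 3 L × Fin (fundamentalLatticeRep 2).N × Fin (fundamentalLatticeRep 2).N × Bool) => (fun z : ℂ => if q.2.2.2 then z.im else z.re) ((fundamentalRep (Fin 2) (V q.1) : Matrix (Fin 2) (Fin 2) ℂ) q.2.1 q.2.2.1)) V with hy₀
  set σ : (Edge 3 L × NoiseIdx (fundamentalLatticeRep 2).N) → (Edge 3 L × Fin (fundamentalLatticeRep 2).N × Fin (fundamentalLatticeRep 2).N × Bool → ℝ) → (Edge 3 L × Fin (fundamentalLatticeRep 2).N × Fin (fundamentalLatticeRep 2).N × Bool → ℝ) := fun n z => (fun q : Edge 3 L × Fin (fundamentalLatticeRep 2).N × Fin (fundamentalLatticeRep 2).N × Bool => if n.1 = q.1 then (fun z : ℂ => if q.2.2.2 then z.im else z.re) (((Real.sqrt 2 : ℂ) • ((fundamentalLatticeRep 2).lieProj (noiseDir n.2) * (fun (ee : Edge 3 L) => Matrix.of fun (i j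 : Fin (fundamentalLatticeRep 2).N) => ((z (ee, i, j, false) : ℝ) : ℂ) + ((z (ee, i, j, true) : ℝ) : ℂ) * Complex.I) q.1)) q.2.1 q.2.2.1) else 0) with hσ
  -- unitary links, the direction of the frame field
  have hrebV : reb y₀ = fun e => Matrix.of fun i j : Fin (fundamentalLatticeRep 2).N => (fundamentalRep (Fin 2) (V e) : Matrix (Fin 2) (Fin 2) ℂ) i j :=
    rebuild_coords_of V
  have hU : ∀ e', reb y₀ e' ∈ Matrix.unitaryGroup (Fin (fundamentalLatticeRep 2).N) ℂ := by
    intro e'; rw [hrebV]; exact Matrix.specialUnitaryGroup_le_unitaryGroup (V e').2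
  -- per-translate differentiability and frame bound (word calculus)
  have hword : ∀ (n : Edge 3 L × NoiseIdx (fundamentalLatticeRep 2).N) (x : Site 3 L),
      DifferentiableAt ℝ (fun y : (Edge 3 L × Fin (fundamentalLatticeRep 2).N × Fin (fundamentalLatticeRep 2).N × Bool → ℝ) => ((((ps.map (fun q : Site 3 L × Fin 3 × Bool => ((x + q.1, q.2.1), q.2.2))).map (fun a : Edge 3 L × Bool => if a.2 then ((reb y) a.1)ᴴ else (reb y) a.1)).prod)).trace.re) y₀ ∧
      |fderiv ℝ (fun y : (Edge 3 L × Fin (fundamentalLatticeRep 2).N × Fin (fundamentalLatticeRep 2).N × Bool → ℝ) => ((((ps.map (fun q : Site 3 L × Fin 3 × Bool => ((x + q.1, q.2.1), q.2.2))).map (fun a : Edge 3 L × Bool => if a.2 then ((reb y) a.1)ᴴ else (reb y) a.1)).prod)).trace.re) y₀ (σ n y₀)| ≤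
        2 * (((ps.map (fun q : Site 3 L × Fin 3 × Bool => ((x + q.1, q.2.1), q.2.2))).countP fun a => a.1 = n.1 : ℕ) : ℝ) := by
    intro n x
    have hv : (fun (ee : Edge 3 L) => Matrix.of fun (i j : Fin (fundamentalLatticeRep 2).N) => (((σ n y₀) (ee, i, j, false) : ℝ) : ℂ) + (((σ n y₀) (ee, i, j, true) : ℝ) : ℂ) * Complex.I) = fun e' => if e' = n.1 then (Real.sqrt 2 : ℂ) • ((fundamentalLatticeRep 2).lieProj (noiseDir n.2) * reb y₀ n.1) else 0 := by
      have h := rebuild_noise n y₀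
      refine h.trans ?_
      funext e'
      by_cases he : e' = n.1
      · rw [if_pos he, if_pos he.symm, he]
      · rw [if_neg he, if_neg (Ne.symm he)]
    obtain ⟨hdiff, -⟩ := word_fderiv_trace_bound y₀ (σ n y₀) n.1 _ hU hv one_pos (ps.map (fun q : Site 3 L × Fin 3 × Bool => ((x + q.1, q.2.1), q.2.2))) 1 1
      (Matrix.unitaryGroup (Fin (fundamentalLatticeRep 2).N) ℂ).one_mem (Matrix.unitaryGroup (Fin (fundamentalLatticeRep 2).N) ℂ).one_mem
    refine ⟨?_, ?_⟩
    · exact ((reTrCLM (n := Fin (fundamentalLatticeRep 2).N)).differentiableAt).comp y₀ hdiff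
    · exact word_frameDeriv_abs_le V n (ps.map (fun q : Site 3 L × Fin 3 × Bool => ((x + q.1, q.2.1), q.2.2)))
  -- the derivative of the averaged functional
  have hderiv : ∀ n : Edge 3 L × NoiseIdx (fundamentalLatticeRep 2).N, fderiv ℝ (fun y : (Edge 3 L × Fin (fundamentalLatticeRep 2).N × Fin (fundamentalLatticeRep 2).N × Bool → ℝ) => c * ∑ x ∈ B, ((((ps.map (fun q : Site 3 L × Fin 3 × Bool => ((x + q.1, q.2.1), q.2.2))).map (fun a : Edge 3 L × Bool => if a.2 then ((fun (ee : Edge 3 L) => Matrix.of fun (i j : Fin (fundamentalLatticeRep 2).N) => ((y (ee, i, j, false) : ℝ) : ℂ) + ((y (ee, i, j, true) : ℝ) : ℂ) * Complex.I) a.1)ᴴ else (fun (ee : Edge 3 L) => Matrix.of fun (i j : Fin (fundamentalLatticeRep 2).N) => ((y (ee, i, j, false) : ℝ) : ℂ) + ((y (ee, i, j, true) : ℝ) : ℂ) * Complex.I) a.1)).prod)).trace.re) y₀ (σ n y₀) =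
      c * ∑ x ∈ B, fderiv ℝ (fun y : (Edge 3 L × Fin (fundamentalLatticeRep 2).N × Fin (fundamentalLatticeRep 2).N × Bool → ℝ) => ((((ps.map (fun q : Site 3 L × Fin 3 × Bool => ((x + q.1, q.2.1), q.2.2))).map (fun a : Edge 3 L × Bool => if a.2 then ((reb y) a.1)ᴴ else (reb y) a.1)).prod)).trace.re) y₀ (σ n y₀) := by
    intro n
    have hsum : HasFDerivAt (fun y : (Edge 3 L × Fin (fundamentalLatticeRep 2).N × Fin (fundamentalLatticeRep 2).N × Bool → ℝ) => ∑ x ∈ B, ((((ps.map (fun q : Site 3 L × Fin 3 × Bool => ((x + q.1, q.2.1), q.2.2))).map (fun a : Edge 3 L × Bool => if a.2 then ((reb y) a.1)ᴴ else (reb y) a.1)).prod)).trace.re)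
        (∑ x ∈ B, fderiv ℝ (fun y : (Edge 3 L × Fin (fundamentalLatticeRep 2).N × Fin (fundamentalLatticeRep 2).N × Bool → ℝ) => ((((ps.map (fun q : Site 3 L × Fin 3 × Bool => ((x + q.1, q.2.1), q.2.2))).map (fun a : Edge 3 L × Bool => if a.2 then ((reb y) a.1)ᴴ else (reb y) a.1)).prod)).trace.re) y₀) y₀ :=
      HasFDerivAt.fun_sum fun x _ => (hword n x).1.hasFDerivAt
    have h := hsum.const_mul c
    rw [show (fun y : (Edge 3 L × Fin (fundamentalLatticeRep 2).N × Fin (fundamentalLatticeRep 2).N × Bool → ℝ) => c * ∑ x ∈ B, ((((ps.map (fun q : Site 3 L × Fin 3 × Bool => ((x + q.1, q.2.1), q.2.2))).map (fun a : Edge 3 L × Bool => if a.2 then ((fun (ee : Edge 3 L) => Matrix.of fun (i j : Fin (fundamentalLatticeRep 2).N) => ((y (ee, i, j, false) : ℝ) : ℂ) + ((y (ee, i, j, true) : ℝ) : ℂ) * Complex.I) a.1)ᴴ else (fun (ee : Edge 3 L) => Matrix.of fun (i j : Fin (fundamentalLatticeRep 2).N) => ((y (ee, i, j, false) : ℝ)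 : ℂ) + ((y (ee, i, j, true) : ℝ) : ℂ) * Complex.I) a.1)).prod)).trace.re) = fun y => c * ∑ x ∈ B, ((((ps.map (fun q : Site 3 L × Fin 3 × Bool => ((x + q.1, q.2.1), q.2.2))).map (fun a : Edge 3 L × Bool => if a.2 then ((reb y) a.1)ᴴ else (reb y) a.1)).prod)).trace.re from rfl, h.fderiv]
    rw [_root_.smul_apply, smul_eq_mul, _root_.sum_apply]
  -- the bound on each frame derivative
  have hlen : ∀ n : Edge 3 L × NoiseIdx (fundamentalLatticeRep 2).N, ∑ x ∈ B, (((ps.map (fun q : Site 3 L × Fin 3 × Bool => ((x + q.1, q.2.1), q.2.2))).countP fun a => a.1 = n.1 : ℕ) : ℝ) ≤ ps.length :=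
    fun n => (Finset.sum_le_univ_sum_of_nonneg fun x => by positivity).trans (sum_countP_translate_le n.1 ps)
  have hbound : ∀ n : Edge 3 L × NoiseIdx (fundamentalLatticeRep 2).N, |fderiv ℝ (fun y : (Edge 3 L × Fin (fundamentalLatticeRep 2).N × Fin (fundamentalLatticeRep 2).N × Bool → ℝ) => c * ∑ x ∈ B, ((((ps.map (fun q : Site 3 L × Fin 3 × Bool => ((x + q.1, q.2.1), q.2.2))).map (fun a : Edge 3 L × Bool => if a.2 then ((fun (ee : Edge 3 L) => Matrix.of fun (i j : Fin (fundamentalLatticeRep 2).N) => ((y (ee, i, j, false) : ℝ) : ℂ) + ((y (ee, i, j, true) : ℝ) : ℂ) * Complex.I) a.1)ᴴ else (fun (ee : Edge 3 L) => Matrix.of fun (i j : Fin (fundamentalLatticeRep 2).N) => ((y (ee, i, j, false) : ℝ) : ℂ) + ((y (ee, i, j, true) : ℝ) : ℂ) * Complex.I) a.1)).prod)).trace.re) y₀ (σ n y₀)| ≤ 2 * |c| * ps.length := by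
    intro n
    rw [hderiv n, abs_mul]
    have h1 : |∑ x ∈ B, fderiv ℝ (fun y : (Edge 3 L × Fin (fundamentalLatticeRep 2).N × Fin (fundamentalLatticeRep 2).N × Bool → ℝ) => ((((ps.map (fun q : Site 3 L × Fin 3 × Bool => ((x + q.1, q.2.1), q.2.2))).map (fun a : Edge 3 L × Bool => if a.2 then ((reb y) a.1)ᴴ else (reb y) a.1)).prod)).trace.re) y₀ (σ n y₀)| ≤ 2 * ps.length := by
      calc |∑ x ∈ B, fderiv ℝ (fun y : (Edge 3 L × Fin (fundamentalLatticeRep 2).N × Fin (fundamentalLatticeRep 2).N × Bool → ℝ) => ((((ps.map (fun q : Site 3 L × Fin 3 × Bool => ((x + q.1, q.2.1), q.2.2))).map (fun a : Edge 3 L × Bool => if a.2 then ((reb y) a.1)ᴴ else (reb y) a.1)).prod)).trace.re) y₀ (σ n y₀)|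
          ≤ ∑ x ∈ B, |fderiv ℝ (fun y : (Edge 3 L × Fin (fundamentalLatticeRep 2).N × Fin (fundamentalLatticeRep 2).N × Bool → ℝ) => ((((ps.map (fun q : Site 3 L × Fin 3 × Bool => ((x + q.1, q.2.1), q.2.2))).map (fun a : Edge 3 L × Bool => if a.2 then ((reb y) a.1)ᴴ else (reb y) a.1)).prod)).trace.re) y₀ (σ n y₀)| := Finset.abs_sum_le_sum_abs _ _
        _ ≤ ∑ x ∈ B, 2 * (((ps.map (fun q : Site 3 L × Fin 3 × Bool => ((x + q.1, q.2.1), q.2.2))).countP fun a => a.1 = n.1 : ℕ) : ℝ) := Finset.sum_le_sum fun x _ => (hword n x).2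
        _ = 2 * ∑ x ∈ B, (((ps.map (fun q : Site 3 L × Fin 3 × Bool => ((x + q.1, q.2.1), q.2.2))).countP fun a => a.1 = n.1 : ℕ) : ℝ) := by rw [Finset.mul_sum]
        _ ≤ 2 * ps.length := by linarith [hlen n]
    calc |c| * |∑ x ∈ B, fderiv ℝ (fun y : (Edge 3 L × Fin (fundamentalLatticeRep 2).N × Fin (fundamentalLatticeRep 2).N × Bool → ℝ) => ((((ps.map (fun q : Site 3 L × Fin 3 × Bool => ((x + q.1, q.2.1), q.2.2))).map (fun a : Edge 3 L × Bool => if a.2 then ((reb y) a.1)ᴴ else (reb y) a.1)).prod)).trace.re) y₀ (σ n y₀)|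
        ≤ |c| * (2 * ps.length) := mul_le_mul_of_nonneg_left h1 (abs_nonneg c)
      _ = 2 * |c| * ps.length := by ring
  -- sparsity-aware bound: `|D_n| ≤ 2|c|·S_n`, `S_n ≤ |ℓ|`, hence `D_n² ≤ 4c²|ℓ|·S_n`
  have hSn : ∀ n : Edge 3 L × NoiseIdx (fundamentalLatticeRep 2).N, |fderiv ℝ (fun y : (Edge 3 L × Fin (fundamentalLatticeRep 2).N × Fin (fundamentalLatticeRep 2).N × Bool → ℝ) => c * ∑ x ∈ B, ((((ps.map (fun q : Site 3 L × Fin 3 × Bool => ((x + q.1, q.2.1), q.2.2))).map (fun a : Edge 3 L × Bool => if a.2 then ((fun (ee : Edge 3 L) => Matrix.of fun (i j : Fin (fundamentalLatticeRep 2).N) => ((y (ee, i, j, false) : ℝ) : ℂ) + ((y (ee, i, j, true) : ℝ) : ℂ) * Complex.I) a.1)ᴴ else (fun (ee : Edge 3 L) => Matrix.of fun (i j : Fin (fundamentalLatticeRep 2).N) => ((y (ee, i, j, false) : ℝ) : ℂ) + ((y (ee, i, j, true) : ℝ) : ℂ) * Complex.I) a.1)).prod)).trace.re) y₀ (σ n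 y₀)| ≤ 2 * |c| * ∑ x ∈ B, (((ps.map (fun q : Site 3 L × Fin 3 × Bool => ((x + q.1, q.2.1), q.2.2))).countP fun a => a.1 = n.1 : ℕ) : ℝ) := by
    intro n
    rw [hderiv n, abs_mul]
    have h1 : |∑ x ∈ B, fderiv ℝ (fun y : (Edge 3 L × Fin (fundamentalLatticeRep 2).N × Fin (fundamentalLatticeRep 2).N × Bool → ℝ) => ((((ps.map (fun q : Site 3 L × Fin 3 × Bool => ((x + q.1, q.2.1), q.2.2))).map (fun a : Edge 3 L × Bool => if a.2 then ((reb y) a.1)ᴴ else (reb y) a.1)).prod)).trace.re) y₀ (σ n y₀)| ≤ 2 * ∑ x ∈ B, (((ps.map (fun q : Site 3 L × Fin 3 × Bool => ((x + q.1, q.2.1), q.2.2))).countP fun a => a.1 = n.1 : ℕ) : ℝ) := by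
      calc |∑ x ∈ B, fderiv ℝ (fun y : (Edge 3 L × Fin (fundamentalLatticeRep 2).N × Fin (fundamentalLatticeRep 2).N × Bool → ℝ) => ((((ps.map (fun q : Site 3 L × Fin 3 × Bool => ((x + q.1, q.2.1), q.2.2))).map (fun a : Edge 3 L × Bool => if a.2 then ((reb y) a.1)ᴴ else (reb y) a.1)).prod)).trace.re) y₀ (σ n y₀)|
          ≤ ∑ x ∈ B, |fderiv ℝ (fun y : (Edge 3 L × Fin (fundamentalLatticeRep 2).N × Fin (fundamentalLatticeRep 2).N × Bool → ℝ) => ((((ps.map (fun q : Site 3 L × Fin 3 × Bool => ((x + q.1, q.2.1), q.2.2))).map (fun a : Edge 3 L × Bool => if a.2 then ((reb y) a.1)ᴴ else (reb y) a.1)).prod)).trace.re) y₀ (σ n y₀)| := Finset.abs_sum_le_sum_abs _ _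
        _ ≤ ∑ x ∈ B, 2 * (((ps.map (fun q : Site 3 L × Fin 3 × Bool => ((x + q.1, q.2.1), q.2.2))).countP fun a => a.1 = n.1 : ℕ) : ℝ) := Finset.sum_le_sum fun x _ => (hword n x).2
        _ = 2 * ∑ x ∈ B, (((ps.map (fun q : Site 3 L × Fin 3 × Bool => ((x + q.1, q.2.1), q.2.2))).countP fun a => a.1 = n.1 : ℕ) : ℝ) := by rw [Finset.mul_sum]
    calc |c| * |∑ x ∈ B, fderiv ℝ (fun y : (Edge 3 L × Fin (fundamentalLatticeRep 2).N × Fin (fundamentalLatticeRep 2).N × Bool → ℝ) => ((((ps.map (fun q : Site 3 L × Fin 3 × Bool => ((x + q.1, q.2.1), q.2.2))).map (fun a : Edge 3 L × Bool => if a.2 then ((reb y) a.1)ᴴ else (reb y) a.1)).prod)).trace.re) y₀ (σ n y₀)| ≤ |c| * (2 * ∑ x ∈ B, (((ps.map (fun q : Site 3 L × Fin 3 × Bool => ((x + q.1, q.2.1), q.2.2))).countP fun a => a.1 = n.1 : ℕ) : ℝ)) := mul_le_mul_of_nonneg_left h1 (abs_nonneg c)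
      _ = 2 * |c| * ∑ x ∈ B, (((ps.map (fun q : Site 3 L × Fin 3 × Bool => ((x + q.1, q.2.1), q.2.2))).countP fun a => a.1 = n.1 : ℕ) : ℝ) := by ring
  have hsq : ∀ n : Edge 3 L × NoiseIdx (fundamentalLatticeRep 2).N, (fderiv ℝ (fun y : (Edge 3 L × Fin (fundamentalLatticeRep 2).N × Fin (fundamentalLatticeRep 2).N × Bool → ℝ) => c * ∑ x ∈ B, ((((ps.map (fun q : Site 3 L × Fin 3 × Bool => ((x + q.1, q.2.1), q.2.2))).map (fun a : Edge 3 L × Bool => if a.2 then ((fun (ee : Edge 3 L) => Matrix.of fun (i j : Fin (fundamentalLatticeRep 2).N) => ((y (ee, i, j, false) : ℝ) : ℂ) + ((y (ee, i, j, true) : ℝ) : ℂ) * Complex.I) a.1)ᴴ else (fun (ee : Edge 3 L) => Matrix.of fun (i j : Fin (fundamentalLatticeRep 2).N) => ((y (ee, i, j, false) : ℝ) : ℂ) + ((y (ee, i, j, true) : ℝ) : ℂ) * Complex.I) a.1)).prod)).trace.re) y₀ (σ n y₀)) ^ 2 ≤ 4 * c ^ 2 * (ps.length : ℝ) * ∑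 x ∈ B, (((ps.map (fun q : Site 3 L × Fin 3 × Bool => ((x + q.1, q.2.1), q.2.2))).countP fun a => a.1 = n.1 : ℕ) : ℝ) := by
    intro n
    have hS0 : 0 ≤ ∑ x ∈ B, (((ps.map (fun q : Site 3 L × Fin 3 × Bool => ((x + q.1, q.2.1), q.2.2))).countP fun a => a.1 = n.1 : ℕ) : ℝ) := Finset.sum_nonneg fun x _ => by positivity
    have h := hSn n
    have hl := hlen n
    have hD0 := abs_nonneg (fderiv ℝ (fun y : (Edge 3 L × Fin (fundamentalLatticeRep 2).N × Fin (fundamentalLatticeRep 2).N × Bool → ℝ) => c * ∑ x ∈ B, ((((ps.map (fun q : Site 3 L × Fin 3 × Bool => ((x + q.1, q.2.1), q.2.2))).map (fun a : Edge 3 L × Bool => if a.2 then ((fun (ee : Edge 3 L) => Matrix.of fun (i j : Fin (fundamentalLatticeRep 2).N) => ((y (ee, i, j, false) : ℝ) : ℂ) + ((y (ee, i, j, true) : ℝ) : ℂ) * Complex.I) a.1)ᴴ else (fun (ee : Edge 3 L) => Matrix.of fun (i j : Fin (fundamentalLatticeRep 2).N) => ((y (ee, i, j, false) : ℝ) : ℂ)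 + ((y (ee, i, j, true) : ℝ) : ℂ) * Complex.I) a.1)).prod)).trace.re) y₀ (σ n y₀))
    calc (fderiv ℝ (fun y : (Edge 3 L × Fin (fundamentalLatticeRep 2).N × Fin (fundamentalLatticeRep 2).N × Bool → ℝ) => c * ∑ x ∈ B, ((((ps.map (fun q : Site 3 L × Fin 3 × Bool => ((x + q.1, q.2.1), q.2.2))).map (fun a : Edge 3 L × Bool => if a.2 then ((fun (ee : Edge 3 L) => Matrix.of fun (i j : Fin (fundamentalLatticeRep 2).N) => ((y (ee, i, j, false) : ℝ) : ℂ) + ((y (ee, i, j, true) : ℝ) : ℂ) * Complex.I) a.1)ᴴ else (fun (ee : Edge 3 L) => Matrix.of fun (i j : Fin (fundamentalLatticeRep 2).N) => ((y (ee, i, j, false) : ℝ) : ℂ) + ((y (ee, i, j, true) : ℝ) : ℂ) * Complex.I) a.1)).prod)).trace.re) y₀ (σ n y₀)) ^ 2 = |fderiv ℝ (fun y : (Edge 3 L × Fin (fundamentalLatticeRep 2).N × Fin (fundamentalLatticeRep 2).N × Bool → ℝ) => c * ∑ x ∈ B, ((((ps.map (fun q : Site 3 L × Fin 3 × Bool =>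 ((x + q.1, q.2.1), q.2.2))).map (fun a : Edge 3 L × Bool => if a.2 then ((fun (ee : Edge 3 L) => Matrix.of fun (i j : Fin (fundamentalLatticeRep 2).N) => ((y (ee, i, j, false) : ℝ) : ℂ) + ((y (ee, i, j, true) : ℝ) : ℂ) * Complex.I) a.1)ᴴ else (fun (ee : Edge 3 L) => Matrix.of fun (i j : Fin (fundamentalLatticeRep 2).N) => ((y (ee, i, j, false) : ℝ) : ℂ) + ((y (ee, i, j, true) : ℝ) : ℂ) * Complex.I) a.1)).prod)).trace.re) y₀ (σ n y₀)| ^ 2 := (sq_abs _).symm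
      _ ≤ (2 * |c| * ∑ x ∈ B, (((ps.map (fun q : Site 3 L × Fin 3 × Bool => ((x + q.1, q.2.1), q.2.2))).countP fun a => a.1 = n.1 : ℕ) : ℝ)) ^ 2 := pow_le_pow_left₀ hD0 h 2
      _ = 4 * c ^ 2 * (∑ x ∈ B, (((ps.map (fun q : Site 3 L × Fin 3 × Bool => ((x + q.1, q.2.1), q.2.2))).countP fun a => a.1 = n.1 : ℕ) : ℝ)) * (∑ x ∈ B, (((ps.map (fun q : Site 3 L × Fin 3 × Bool => ((x + q.1, q.2.1), q.2.2))).countP fun a => a.1 = n.1 : ℕ) : ℝ)) := by rw [mul_pow, mul_pow, sq_abs]; ring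
      _ ≤ 4 * c ^ 2 * (ps.length : ℝ) * ∑ x ∈ B, (((ps.map (fun q : Site 3 L × Fin 3 × Bool => ((x + q.1, q.2.1), q.2.2))).countP fun a => a.1 = n.1 : ℕ) : ℝ) := by
          apply mul_le_mul_of_nonneg_right _ hS0
          exact mul_le_mul_of_nonneg_left hl (by positivity)
  -- `Σ_n S_n = 8·|ℓ|·#B`
  have hcountE : ∀ l : List (Edge 3 L × Bool), ∑ e : Edge 3 L, ((l.countP fun a => a.1 = e : ℕ) : ℝ) = l.length := by
    intro l
    induction l with
    | nil => simp
    | cons a l ih =>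
        have hstep : ∀ e : Edge 3 L, (((a :: l).countP fun a' => a'.1 = e : ℕ) : ℝ) = ((l.countP fun a' => a'.1 = e : ℕ) : ℝ) + (if a.1 = e then (1 : ℝ) else 0) := by
          intro e
          rw [List.countP_cons]
          push_cast
          by_cases h : a.1 = e
          · simp [h]
          · simp [h]
        simp_rw [hstep]
        rw [Finset.sum_add_distrib, ih, Finset.sum_ite_eq, List.length_cons]
        simp
  have hNoise : (Fintype.card (NoiseIdx (fundamentalLatticeRep 2).N) : ℝ) = 8 := by
    have h := card_edge_noiseIdx L
    rw [Fintype.card_prod] at h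
    have hE : 0 < Fintype.card (Edge 3 L) := Fintype.card_pos
    have h8 : Fintype.card (NoiseIdx (fundamentalLatticeRep 2).N) = 8 := by
      have := Nat.eq_of_mul_eq_mul_left hE (h.trans (mul_comm _ _))
      exact this
    exact_mod_cast h8
  have htotal : ∑ n : Edge 3 L × NoiseIdx (fundamentalLatticeRep 2).N, ∑ x ∈ B, (((ps.map (fun q : Site 3 L × Fin 3 × Bool => ((x + q.1, q.2.1), q.2.2))).countP fun a => a.1 = n.1 : ℕ) : ℝ) = 8 * (ps.length : ℝ) * (B.card : ℝ) := by
    rw [Finset.sum_comm]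
    have hinner : ∀ x ∈ B, ∑ n : Edge 3 L × NoiseIdx (fundamentalLatticeRep 2).N, (((ps.map (fun q : Site 3 L × Fin 3 × Bool => ((x + q.1, q.2.1), q.2.2))).countP fun a => a.1 = n.1 : ℕ) : ℝ) = 8 * (ps.length : ℝ) := by
      intro x _
      rw [Fintype.sum_prod_type]
      calc ∑ e : Edge 3 L, ∑ _ν : NoiseIdx (fundamentalLatticeRep 2).N, (((ps.map (fun q : Site 3 L × Fin 3 × Bool => ((x + q.1, q.2.1), q.2.2))).countP fun a => a.1 = e : ℕ) : ℝ)
          = ∑ e : Edge 3 L, (Fintype.card (NoiseIdx (fundamentalLatticeRep 2).N) : ℝ) * (((ps.map (fun q : Site 3 L × Fin 3 × Bool => ((x + q.1, q.2.1), q.2.2))).countP fun a => a.1 = e : ℕ) : ℝ) := by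
            refine Finset.sum_congr rfl fun e _ => ?_
            rw [Finset.sum_const, Finset.card_univ, nsmul_eq_mul]
        _ = 8 * ∑ e : Edge 3 L, (((ps.map (fun q : Site 3 L × Fin 3 × Bool => ((x + q.1, q.2.1), q.2.2))).countP fun a => a.1 = e : ℕ) : ℝ) := by rw [← Finset.mul_sum, hNoise]
        _ = 8 * (ps.length : ℝ) := by rw [hcountE, List.length_map]
    rw [Finset.sum_congr rfl hinner, Finset.sum_const, nsmul_eq_mul]
    ring
  have hsV : ∀ k : Edge 3 L × NoiseIdx (fundamentalLatticeRep 2).N, σ k y₀ = (fun q : Edge 3 L × Fin (fundamentalLatticeRep 2).N × Fin (fundamentalLatticeRep 2).N × Bool => if k.1 = q.1 then (fun z : ℂ => if q.2.2.2 then z.im else z.re) (((Real.sqrt 2 : ℂ) • ((fundamentalLatticeRep 2).lieProj (noiseDir k.2) * (fun (ee : Edge 3 L) => Matrix.of fun (i j : Fin (fundamentalLatticeRep 2).N) => ((y₀ (ee, i, j, false) : ℝ) : ℂ) + ((y₀ (ee, i, j, true) : ℝ) : ℂ) * Complex.I) q.1)) q.2.1 q.2.2.1) else 0) := fun k => rf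l
  calc ∑ n : Edge 3 L × NoiseIdx (fundamentalLatticeRep 2).N, (fderiv ℝ (fun y : (Edge 3 L × Fin (fundamentalLatticeRep 2).N × Fin (fundamentalLatticeRep 2).N × Bool → ℝ) => c * ∑ x ∈ B, ((((ps.map (fun q : Site 3 L × Fin 3 × Bool => ((x + q.1, q.2.1), q.2.2))).map (fun a : Edge 3 L × Bool => if a.2 then ((fun (ee : Edge 3 L) => Matrix.of fun (i j : Fin (fundamentalLatticeRep 2).N) => ((y (ee, i, j, false) : ℝ) : ℂ) + ((y (ee, i, j, true) : ℝ) : ℂ) * Complex.I) a.1)ᴴ else (fun (ee : Edge 3 L) => Matrix.of fun (i j : Fin (fundamentalLatticeRep 2).N) => ((y (ee, i, j, false) : ℝ) : ℂ) + ((y (ee, i, j, true) : ℝ) : ℂ) * Complex.I) a.1)).prod)).trace.re) y₀ (fun q : Edge 3 L × Fin (fundamentalLatticeRep 2).N × Fin (fundamentalLatticeRep 2).N × Bool => if n.1 = q.1 then (fun z : ℂ => if q.2.2.2 then z.im else z.re) (((Real.sqrt 2 : ℂ) • ((fundamentalLatticeRep 2).lieProj (noiseDir n.2) * (fun (ee :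 Edge 3 L) => Matrix.of fun (i j : Fin (fundamentalLatticeRep 2).N) => ((y₀ (ee, i, j, false) : ℝ) : ℂ) + ((y₀ (ee, i, j, true) : ℝ) : ℂ) * Complex.I) q.1)) q.2.1 q.2.2.1) else 0)) ^ 2
      = ∑ n : Edge 3 L × NoiseIdx (fundamentalLatticeRep 2).N, (fderiv ℝ (fun y : (Edge 3 L × Fin (fundamentalLatticeRep 2).N × Fin (fundamentalLatticeRep 2).N × Bool → ℝ) => c * ∑ x ∈ B, ((((ps.map (fun q : Site 3 L × Fin 3 × Bool => ((x + q.1, q.2.1), q.2.2))).map (fun a : Edge 3 L × Bool => if a.2 then ((fun (ee : Edge 3 L) => Matrix.of fun (i j : Fin (fundamentalLatticeRep 2).N) => ((y (ee, i, j, false) : ℝ) : ℂ) + ((y (ee, i, j, true) : ℝ) : ℂ) * Complex.I) a.1)ᴴ else (fun (ee : Edge 3 L) => Matrix.of fun (i j : Fin (fundamentalLatticeRep 2).N) => ((y (ee, i, j, false) : ℝ) : ℂ) + ((y (ee, i, j, true) : ℝ) : ℂ) * Complex.I) a.1)).prod)).trace.re) y₀ (σ n y₀)) ^ 2 := by simp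 only [hsV]
    _ ≤ ∑ n : Edge 3 L × NoiseIdx (fundamentalLatticeRep 2).N, 4 * c ^ 2 * (ps.length : ℝ) * ∑ x ∈ B, (((ps.map (fun q : Site 3 L × Fin 3 × Bool => ((x + q.1, q.2.1), q.2.2))).countP fun a => a.1 = n.1 : ℕ) : ℝ) := Finset.sum_le_sum fun n _ => hsq n
    _ = 4 * c ^ 2 * (ps.length : ℝ) * ∑ n : Edge 3 L × NoiseIdx (fundamentalLatticeRep 2).N, ∑ x ∈ B, (((ps.map (fun q : Site 3 L × Fin 3 × Bool => ((x + q.1, q.2.1), q.2.2))).countP fun a => a.1 = n.1 : ℕ) : ℝ) := by rw [Finset.mul_sum]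
    _ = 32 * c ^ 2 * (ps.length : ℝ) ^ 2 * (B.card : ℝ) := by rw [htotal]; ring

end Calculus

/-! ## §2. Smoothness and the coordinate form -/

/-- **The block-averaged loop functional is smooth** in the link coordinates (a polynomial; entrywise induction on the word). [folklore] -/
theorem contDiff_blockLoopAverage (ps : List (Site 3 L × Fin 3 × Bool)) (c : ℝ) (B : Finset (Site 3 L)) {m : WithTop ℕ∞} :
    ContDiff ℝ m (fun y : (Edge 3 L × Fin 2 × Fin 2 × Bool → ℝ) => c * ∑ x ∈ B, ((((ps.map (fun q : Site 3 L × Fin 3 × Bool => ((x + q.1, q.2.1), q.2.2))).map (fun a : Edge 3 L × Bool => if a.2 then ((fun (ee : Edge 3 L) => Matrix.of fun (i j : Fin 2) => ((y (ee, i, j, false) : ℝ) : ℂ) + ((y (ee, i, j, true) : ℝ) : ℂ) * Complex.I) a.1)ᴴ else (fun (ee : Edge 3 L) => Matrix.of fun (i j : Fin 2) => ((y (ee, i, j, false) : ℝ) : ℂ) + ((y (ee, i, j, true) : ℝ) : ℂ) * Complex.I) a.1)).prod)).trace.re) := by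
  classical
  set reb : (Edge 3 L × Fin 2 × Fin 2 × Bool → ℝ) → (Edge 3 L → Matrix (Fin 2) (Fin 2) ℂ) := fun z => (fun (ee : Edge 3 L) => Matrix.of fun (i j : Fin 2) => ((z (ee, i, j, false) : ℝ) : ℂ) + ((z (ee, i, j, true) : ℝ) : ℂ) * Complex.I) with hreb
  -- letters are smooth, entrywise
  have hletter : ∀ (a : Edge 3 L × Bool) (i j : Fin 2), ContDiff ℝ m fun y : (Edge 3 L × Fin 2 × Fin 2 × Bool → ℝ) => (fun a : Edge 3 L × Bool => if a.2 then ((reb y) a.1)ᴴ else (reb y) a.1) a i j := by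
    intro a i j
    obtain ⟨e', b⟩ := a
    cases b
    · simp only [Bool.false_eq_true, if_false]
      exact contDiff_entry_rebuild (N := 2) e' i j
    · simp only [if_true]
      exact contDiff_entry_conjTranspose (fun i j => contDiff_entry_rebuild (N := 2) e' i j) i j
  have hwordC : ∀ (l : List (Edge 3 L × Bool)) (i j : Fin 2), ContDiff ℝ m fun y : (Edge 3 L × Fin 2 × Fin 2 × Bool → ℝ) => (l.map (fun a : Edge 3 L × Bool => if a.2 then ((reb y) a.1)ᴴ else (reb y) a.1)).prod i j := by
    intro l
    induction l with
    | nil =>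
        intro i j
        simp only [List.map_nil, List.prod_nil]
        exact contDiff_const
    | cons a l ih =>
        intro i j
        have h : (fun y : (Edge 3 L × Fin 2 × Fin 2 × Bool → ℝ) => ((a :: l).map (fun a : Edge 3 L × Bool => if a.2 then ((reb y) a.1)ᴴ else (reb y) a.1)).prod i j) =
            fun y => ((fun a : Edge 3 L × Bool => if a.2 then ((reb y) a.1)ᴴ else (reb y) a.1) a * (l.map (fun a : Edge 3 L × Bool => if a.2 then ((reb y) a.1)ᴴ else (reb y) a.1)).prod) i j := by
          funext y; rw [List.map_cons, List.prod_cons]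
        rw [h]
        exact contDiff_entry_mul (hletter a) ih i j
  refine contDiff_const.mul (ContDiff.sum fun x _ => ?_)
  exact contDiff_re_trace (hwordC _)


/-- ★★ **The carré du champ of the block-averaged loop functional is at most `32c²|ℓ|²·#B`, uniformly** (coordinate form; hypothesis shape of
the transport–entropy bounds `wilson_coldStart_smooth_le_exp_explicit` / `…_of_logSobolev_explicit`). [folklore] -/
theorem wilson_blockLoopAverage_carre_le (L : ℕ) [NeZero L] (β' : ℝ) (ps : List (Site 3 L × Fin 3 × Bool)) (c : ℝ) (B : Finset (Site 3 L)) :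
    let coords : GaugeConfig 3 L (Matrix.specialUnitaryGroup (Fin 2) ℂ) → (Edge 3 L × Fin 2 × Fin 2 × Bool → ℝ) :=
      fun V q => (fun z : ℂ => if q.2.2.2 then z.im else z.re)
        ((fundamentalRep (Fin 2) (V q.1) : Matrix (Fin 2) (Fin 2) ℂ) q.2.1 q.2.2.1)
    let A : GaugeConfig 3 L (Matrix.specialUnitaryGroup (Fin 2) ℂ) → (Edge 3 L × Fin 2 × Fin 2 × Bool) →
        (Edge 3 L × Fin 2 × Fin 2 × Bool) → ℝ := fun V i j =>
      ∑ n : Edge 3 L × NoiseIdx 2,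
        (if n.1 = i.1 then (fun z : ℂ => if i.2.2.2 then z.im else z.re)
          ((latticeLangevinDynamics (fundamentalLatticeRep 2) β').noise
            (matrixConfig (fundamentalRep (Fin 2)) V) i.1 n.2 i.2.1 i.2.2.1) else 0) *
        (if n.1 = j.1 then (fun z : ℂ => if j.2.2.2 then z.im else z.re)
          ((latticeLangevinDynamics (fundamentalLatticeRep 2) β').noise
            (matrixConfig (fundamentalRep (Fin 2)) V) j.1 n.2 j.2.1 j.2.2.1) else 0)
    ∀ V : (GaugeConfig 3 L (Matrix.specialUnitaryGroup (Fin 2) ℂ)), (∑ i : Edge 3 L × Fin 2 × Fin 2 × Bool, ∑ j : Edge 3 L × Fin 2 × Fin 2 × Bool,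
      fderiv ℝ (fun y : (Edge 3 L × Fin 2 × Fin 2 × Bool → ℝ) => c * ∑ x ∈ B, ((((ps.map (fun q : Site 3 L × Fin 3 × Bool => ((x + q.1, q.2.1), q.2.2))).map (fun a : Edge 3 L × Bool => if a.2 then ((fun (ee : Edge 3 L) => Matrix.of fun (i j : Fin 2) => ((y (ee, i, j, false) : ℝ) : ℂ) + ((y (ee, i, j, true) : ℝ) : ℂ) * Complex.I) a.1)ᴴ else (fun (ee : Edge 3 L) => Matrix.of fun (i j : Fin 2) => ((y (ee, i, j, false) : ℝ) : ℂ) + ((y (ee, i, j, true) : ℝ) : ℂ) * Complex.I) a.1)).prod)).trace.re) (coords V) (Pi.single i 1) * fderiv ℝ (fun y : (Edge 3 L × Fin 2 × Fin 2 × Bool → ℝ) => c * ∑ x ∈ B, ((((ps.map (fun q : Site 3 L × Fin 3 × Bool => ((x + q.1, q.2.1), q.2.2))).map (fun a : Edge 3 L × Bool => if a.2 then ((fun (ee : Edge 3 L) => Matrix.of fun (i j : Fin 2) => ((y (ee, i, j, false) : ℝ) : ℂ) + ((y (ee, i, j, true) : ℝ) : ℂ) * Complex.I) a.1)ᴴ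 else (fun (ee : Edge 3 L) => Matrix.of fun (i j : Fin 2) => ((y (ee, i, j, false) : ℝ) : ℂ) + ((y (ee, i, j, true) : ℝ) : ℂ) * Complex.I) a.1)).prod)).trace.re) (coords V) (Pi.single j 1) * A V i j)
        ≤ 32 * c ^ 2 * (ps.length : ℝ) ^ 2 * (B.card : ℝ) := by
  intro coords A V
  classical
  set cV : Edge 3 L × Fin 2 × Fin 2 × Bool → ℝ := coords V with hc
  set Q : MatrixConfig 3 L (fundamentalLatticeRep 2).N := matrixConfig (fundamentalRep (Fin 2)) V with hQdef
  set coordOf : (Fin 2 × Fin 2 × Bool) → Matrix (Fin (fundamentalLatticeRep 2).N) (Fin (fundamentalLatticeRep 2).N) ℂ → ℝ := fun p X =>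
    (fun z : ℂ => if p.2.2 then z.im else z.re) (X p.1 p.2.1) with hcoordOf
  set σ : (Edge 3 L × Fin 2 × Fin 2 × Bool) → (Edge 3 L × NoiseIdx 2) → ℝ := fun i n =>
    if n.1 = i.1 then coordOf i.2 ((latticeLangevinDynamics (fundamentalLatticeRep 2) β').noise Q i.1 n.2) else 0 with hσ
  have hA : ∀ i j, A V i j = ∑ n, σ i n * σ j n := fun i j => rfl
  set D : (Edge 3 L × Fin 2 × Fin 2 × Bool → ℝ) →L[ℝ] ℝ := fderiv ℝ (fun y : (Edge 3 L × Fin 2 × Fin 2 × Bool → ℝ) => c * ∑ x ∈ B, ((((ps.map (fun q : Site 3 L × Fin 3 × Bool => ((x + q.1, q.2.1), q.2.2))).map (fun a : Edge 3 L × Bool => if a.2 then ((fun (ee : Edge 3 L) => Matrix.of fun (i j : Fin 2) => ((y (ee, i, j, false) : ℝ) : ℂ) + ((y (ee, i, j, true) : ℝ) : ℂ) * Complex.I) a.1)ᴴ else (fun (ee : Edge 3 L) => Matrix.of fun (i j : Fin 2) => ((y (ee, i, j, false) : ℝ) : ℂ) + ((y (ee, i, j, true) : ℝ) : ℂ) *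 Complex.I) a.1)).prod)).trace.re) cV with hD
  have h1 : ∑ i, ∑ j, D (Pi.single i 1) * D (Pi.single j 1) * A V i j = ∑ n, (D (fun i => σ i n)) ^ 2 := by
    simp_rw [hA]
    rw [sum_sum_mul_mul_noiseCov_eq_sum_sq (fun i => D (Pi.single i 1)) σ]
    exact Finset.sum_congr rfl fun n _ => by rw [sum_apply_single_mul_eq_apply]
  rw [h1]
  have hrebQ : ∀ e : Edge 3 L, (Matrix.of fun a b : Fin (fundamentalLatticeRep 2).N => ((cV (e, a, b, false) : ℝ) : ℂ) + ((cV (e, a, b, true) : ℝ) : ℂ) * Complex.I) = Q e :=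
    fun e => (congrFun (rebuild_coords_of V) e).trans (Matrix.ext fun a b => rfl)
  have hvec : ∀ n : Edge 3 L × NoiseIdx 2, (fun i => σ i n) = (fun q : Edge 3 L × Fin (fundamentalLatticeRep 2).N × Fin (fundamentalLatticeRep 2).N × Bool => if n.1 = q.1 then (fun z : ℂ => if q.2.2.2 then z.im else z.re) (((Real.sqrt 2 : ℂ) • ((fundamentalLatticeRep 2).lieProj (noiseDir n.2) * (fun (ee : Edge 3 L) => Matrix.of fun (i j : Fin (fundamentalLatticeRep 2).N) => ((cV (ee, i, j, false) : ℝ) : ℂ) + ((cV (ee, i, j, true) : ℝ) : ℂ) * Complex.I) q.1)) q.2.1 q.2.2.1) else 0) := by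
    intro n
    funext i
    simp only [hσ, hcoordOf]
    by_cases h : n.1 = i.1
    · rw [if_pos h, if_pos h, latticeLangevinDynamics_noise, hrebQ]
    · rw [if_neg h, if_neg h]
  simp_rw [hvec]
  have h6 : ∑ n : Edge 3 L × NoiseIdx 2, (D (fun q : Edge 3 L × Fin (fundamentalLatticeRep 2).N × Fin (fundamentalLatticeRep 2).N × Bool => if n.1 = q.1 then (fun z : ℂ => if q.2.2.2 then z.im else z.re) (((Real.sqrt 2 : ℂ) • ((fundamentalLatticeRep 2).lieProj (noiseDir n.2) * (fun (ee : Edge 3 L) => Matrix.of fun (i j : Fin (fundamentalLatticeRep 2).N) => ((cV (ee, i, j, false) : ℝ) : ℂ) + ((cV (ee, i, j, true) : ℝ) : ℂ) * Complex.I) q.1)) q.2.1 q.2.2.1) else 0)) ^ 2 ≤ 32 * c ^ 2 * (ps.length : ℝ) ^ 2 * (B.card : ℝ) :=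
    wilson_blockLoopAverage_carreBound L ps c B V
  exact h6

end Summit.QuantumFields.YangMills.Theorems.ColdStartUniversality
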